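import Summits.NavierStokesRegularity.FluidComputer.CriticalDivergence
import Literature.Analysis.FluidPDE.CriticalSpaces
import HarnessLib

/-!
# Fluid computer — the level dictionary, PROFILE FACE (L42): a realised blow-up is not (discretely) self-similar
# about its blow-up time

HONEST FRAMING (cell `pub-fluidc`, verbatim): *low prior, high value-of-information experiment on Tao's
machine paradigm; NOT a claim that NS blows up.* Theorem side of the cell; nothing here is evidence of blow-up.
Leray (1934) asked whether a blow-up could be SELF-SIMILAR, `u(t, x) = (2a(T − t))^{-1/2} U(x/√(2a(T − t)))`;
Nečas–Růžička–Šverák (1996, `U ∈ L³`), Tsai (1998, `U ∈ L^q` / local energy) and Chae–Wolf (2017, discretely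
self-similar) excluded it in wide classes. For the dictionary's class — FINITE-ENERGY classical solutions — the
exclusion is an immediate reading of the critical face L27 (`‖u(t)‖_{L³} → ∞`, Seregin 2012, PROVED in the tree)
through the scale invariance of `L³`: a backward discretely self-similar solution has the SAME `L³` norm along the
geometric sequence of times `t_n = T − λ^{-2n}(T − t₀) ↑ T`. For every maximal smooth solution `(u, p)` of the
unforced Navier–Stokes system on `ℝ³ × [0, T)` (`ν > 0`) which is Leray–Hopf from `u 0`:

* `eLpNorm_three_zoom` (scaling): `‖λ u(s, x₀ + λ(· − x₀))‖_{L³} = ‖u(s)‖_{L³}`;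
* `not_backward_dss` (**L42 — NOT DISCRETELY SELF-SIMILAR**): for every centre `x₀`, factor `λ > 1` and
  `t₀ ∈ [0, T)` it is NOT the case that `u(T − (T − s)/λ², x) = λ u(s, x₀ + λ(x − x₀))` for all `s ∈ (t₀, T)` and
  all `x` (zooming into a later slice by `λ` around `x₀` never reproduces the earlier slice, on any terminal
  window);
* `not_backward_selfSimilar` (**L42′**): in particular `u` is not backward self-similar about `(T, x₀)` on any
  terminal window (the relation for all `λ > 1`).

Reading for the machine paradigm (words): the cascade of a realised blow-up is not a log-periodic repetition of one
zoomed picture — each generation must carry MORE critical mass than the last (L27), whereas exact (discrete)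
self-similarity freezes it. This constrains the 'self-similar design' idealisation of the circuit blueprint only
as an exact identity, not as an approximate architecture. Scale-free; corollary of L27, no new input.
Necessity only. 0 sorry; no new definitions, no named facts.

## References

* J. Leray, Acta Math. 63 (1934) 193–248, (3.11). [Leray1934]
* J. Nečas, M. Růžička, V. Šverák, Acta Math. 176 (1996) 283–294, Thm. 1. [NecasRuzickaSverak1996]
* T.-P. Tsai, Arch. Rational Mech. Anal. 143 (1998) 29–51, Thm. 1. [Tsai1998]
* D. Chae, J. Wolf, Comm. PDE 42 (2017) 1359–1374, Thm. 1.1. [ChaeWolf2017RemovingDSS]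
* G. Seregin, Comm. Math. Phys. 312 (2012) 833–845, Thm. 1.1. [Seregin2012]
-/

noncomputable section

open MeasureTheory Set Function Filter Topology Metric
open scoped ENNReal NNReal
open Literature.Analysis.FluidPDE Literature.Analysis.FunctionSpaces
open Summit.NavierStokesRegularity.FluidComputer.CriticalDivergence

namespace Summit.NavierStokesRegularity.FluidComputer.SelfSimilarFace

/-- **`L³` is invariant under the Navier–Stokes zoom about a point**: for `λ > 0`, a centre `x₀` and a
measurable-enough field `g`, `‖λ • g(x₀ + λ(· − x₀))‖_{L³} = ‖g‖_{L³}` (dilation `eLpNorm_three_rescaleData` and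
translation invariance of Lebesgue measure). [cite: NecasRuzickaSverak1996, (1.3)] -/
theorem eLpNorm_three_zoom {g : EuclideanSpace ℝ (Fin 3) → EuclideanSpace ℝ (Fin 3)}
    (hg : AEStronglyMeasurable g volume) (x₀ : EuclideanSpace ℝ (Fin 3)) {l : ℝ} (hl : 0 < l) :
    eLpNorm (fun x => l • g (x₀ + l • (x - x₀))) 3 volume = eLpNorm g 3 volume := by
  set c : EuclideanSpace ℝ (Fin 3) := x₀ - l • x₀ with hc
  have h1 : (fun x => l • g (x₀ + l • (x - x₀))) = rescaleData l (fun y => g (y + c)) := by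
    funext x
    simp only [rescaleData_apply, hc, smul_sub]
    congr 2
    abel
  rw [h1, eLpNorm_three_rescaleData _ hl]
  have h2 : (fun y => g (y + c)) = g ∘ fun y => y + c := rfl
  rw [h2, eLpNorm_comp_measurePreserving hg (measurePreserving_add_right volume c)]

/-! ## L42: not discretely self-similar -/

/-- **L42 — A REALISED BLOW-UP IS NOT BACKWARD DISCRETELY SELF-SIMILAR.** For `ν > 0`, `T > 0`, every maximal
smooth solution `(u, p)` of the unforced Navier–Stokes system on `ℝ³ × [0, T)` which is Leray–Hopf from `u 0`,
every centre `x₀`, every factor `λ > 1` and every `t₀ ∈ [0, T)`: the solution does NOT satisfy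
`u(T − (T − s)/λ², x) = λ • u(s, x₀ + λ • (x − x₀))` for all `s ∈ (t₀, T)` and all `x`. Proof: along
`t_{n+1} = T − (T − t_n)/λ²` the `L³` norms would all equal `‖u(t_0)‖_{L³} < ∞` (`eLpNorm_three_zoom`,
`memLp_three_slice`), while `t_n ↑ T` and `‖u(t)‖_{L³} → ∞` (L27, `exists_window_eLpNorm_three_gt`).
[cite: Seregin2012, Thm. 1.1] [cite: ChaeWolf2017RemovingDSS, Thm. 1.1] [cite: Tsai1998, Thm. 1] -/
theorem not_backward_dss {ν T : ℝ} (hν : 0 < ν) (hT : 0 < T)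
    {u : ℝ → EuclideanSpace ℝ (Fin 3) → EuclideanSpace ℝ (Fin 3)} {p : ℝ → EuclideanSpace ℝ (Fin 3) → ℝ}
    (hmax : IsMaximalSmoothSolution ν 0 u p T) (hLH : IsLerayHopfOn T ν 0 (u 0) u)
    (x₀ : EuclideanSpace ℝ (Fin 3)) {l : ℝ} (hl : 1 < l) {t₀ : ℝ} (ht₀ : t₀ ∈ Ico 0 T) :
    ¬ ∀ s ∈ Ioo t₀ T, ∀ x : EuclideanSpace ℝ (Fin 3),
        u (T - (T - s) / l ^ 2) x = l • u s (x₀ + l • (x - x₀)) := by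
  intro hdss
  have hl0 : 0 < l := one_pos.trans hl
  have hl2 : 1 < l ^ 2 := by nlinarith
  have hl2pos : 0 < l ^ 2 := by positivity
  -- the first time `s₀ = (t₀ + T)/2` and the geometric sequence `t n = T − (T − s₀)/(λ²)ⁿ`
  set s₀ : ℝ := (t₀ + T) / 2 with hs₀
  have hs₀I : s₀ ∈ Ioo t₀ T := ⟨by rw [hs₀]; linarith [ht₀.2], by rw [hs₀]; linarith [ht₀.2]⟩
  have hs₀0 : 0 < s₀ := ht₀.1.trans_lt hs₀I.1
  set tn : ℕ → ℝ := fun n => T - (T - s₀) / (l ^ 2) ^ n with htn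
  have htn0 : tn 0 = s₀ := by simp [htn]
  have htn_succ : ∀ n, tn (n + 1) = T - (T - tn n) / l ^ 2 := by
    intro n
    simp only [htn, pow_succ]
    field_simp
    ring
  have htn_mem : ∀ n, tn n ∈ Ioo t₀ T := by
    intro n
    have hq : 0 < (T - s₀) / (l ^ 2) ^ n := div_pos (sub_pos.2 hs₀I.2) (pow_pos hl2pos n)
    have hq' : (T - s₀) / (l ^ 2) ^ n ≤ T - s₀ := by
      refine div_le_self (sub_pos.2 hs₀I.2).le (one_le_pow₀ hl2.le)
    refine ⟨?_, ?_⟩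
    · simp only [htn]; linarith [hs₀I.1]
    · simp only [htn]; linarith
  -- the `L³` norm is constant along the sequence
  have hnorm : ∀ n, eLpNorm (u (tn n)) 3 volume = eLpNorm (u s₀) 3 volume := by
    intro n
    induction n with
    | zero => rw [htn0]
    | succ n ih =>
      have hrel : u (tn (n + 1)) = fun x => l • u (tn n) (x₀ + l • (x - x₀)) := by
        funext x
        rw [htn_succ]
        exact hdss (tn n) (htn_mem n) x
      have hmeas : AEStronglyMeasurable (u (tn n)) volume :=
        (hmax.1.contDiff_velocity ⟨(ht₀.1.trans_lt (htn_mem n).1).le, (htn_mem n).2⟩).continuous.aestronglyMeasurable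
      rw [hrel, eLpNorm_three_zoom hmeas x₀ hl0, ih]
  -- the constant is finite
  have hfin : eLpNorm (u s₀) 3 volume < ⊤ := (memLp_three_slice hν hT hmax.1 hLH ⟨hs₀0, hs₀I.2⟩).eLpNorm_lt_top
  set N : ℝ≥0 := (eLpNorm (u s₀) 3 volume).toNNReal with hN
  have hNeq : (N : ℝ≥0∞) = eLpNorm (u s₀) 3 volume := ENNReal.coe_toNNReal hfin.ne
  -- but the `L³` norm diverges (L27)
  obtain ⟨t₁, ht₁, hgt⟩ := exists_window_eLpNorm_three_gt hν hT hmax hLH N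
  -- the sequence enters the window `(t₁, T)`
  have htend : Tendsto tn atTop (𝓝 T) := by
    have h1 : Tendsto (fun n : ℕ => ((l ^ 2)⁻¹) ^ n) atTop (𝓝 0) :=
      tendsto_pow_atTop_nhds_zero_of_lt_one (inv_nonneg.2 hl2pos.le) (inv_lt_one_of_one_lt₀ hl2)
    have h2 : Tendsto (fun n : ℕ => T - (T - s₀) * ((l ^ 2)⁻¹) ^ n) atTop (𝓝 (T - (T - s₀) * 0)) :=
      tendsto_const_nhds.sub (tendsto_const_nhds.mul h1)
    rw [mul_zero, sub_zero] at h2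
    refine h2.congr fun n => ?_
    simp only [htn, inv_pow, div_eq_mul_inv]
  have hev : ∀ᶠ n in atTop, t₁ < tn n := htend.eventually (lt_mem_nhds ht₁)
  obtain ⟨n, hn⟩ := hev.exists
  have hbig := hgt (tn n) ⟨hn, (htn_mem n).2⟩
  rw [hnorm n, ← hNeq] at hbig
  exact lt_irrefl _ hbig

/-- **L42′ — NOT BACKWARD SELF-SIMILAR.** In particular no maximal smooth Leray–Hopf solution is backward
self-similar about `(T, x₀)` on a terminal window: the relation `u(T − (T − s)/λ², x) = λ • u(s, x₀ + λ • (x − x₀))`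
cannot hold for all `λ > 1`, `s ∈ (t₀, T)`, `x` (Leray's ansatz `(2a(T−t))^{-1/2} U((x − x₀)/√(2a(T−t)))`
satisfies it for every `λ`). [cite: Leray1934, (3.11)] [cite: NecasRuzickaSverak1996, Thm. 1] [cite: Seregin2012, Thm. 1.1] -/
theorem not_backward_selfSimilar {ν T : ℝ} (hν : 0 < ν) (hT : 0 < T)
    {u : ℝ → EuclideanSpace ℝ (Fin 3) → EuclideanSpace ℝ (Fin 3)} {p : ℝ → EuclideanSpace ℝ (Fin 3) → ℝ}
    (hmax : IsMaximalSmoothSolution ν 0 u p T) (hLH : IsLerayHopfOn T ν 0 (u 0) u)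
    (x₀ : EuclideanSpace ℝ (Fin 3)) {t₀ : ℝ} (ht₀ : t₀ ∈ Ico 0 T) :
    ¬ ∀ l : ℝ, 1 < l → ∀ s ∈ Ioo t₀ T, ∀ x : EuclideanSpace ℝ (Fin 3),
        u (T - (T - s) / l ^ 2) x = l • u s (x₀ + l • (x - x₀)) :=
  fun h => not_backward_dss hν hT hmax hLH x₀ one_lt_two ht₀ (h 2 one_lt_two)

end Summit.NavierStokesRegularity.FluidComputer.SelfSimilarFace

end
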